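import Summits.Ventures.PercRepro.RankLevelSetRuleQSixteenPitCertLo
import Summits.Ventures.PercRepro.RankLevelSetRuleQSixteenPitCertHi
import Summits.Ventures.PercRepro.RankLevelSetRuleQSixteenPitCore

/-!
# PercRepro — THE FAMILY `k = 16` ON ITS WHOLE UNTRUNCATED REGIME, FOR EVERY `q` (p4, gen 27; C-044; paper
proofs/P4-CELL-THREE.md §13.5, §13.9)

**`rhat_sixteen_whole (q m : ℕ) (hm : m + 15 ≤ q) : phiK (q + 16) q ≤ rhat q 16 m`** — Rule Q's equal split pays `Φ(q+16, q)` to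
EVERY member of EVERY cell `(q+16, q)` with `#P ≤ q − 15` (the whole untruncated regime `u = q − #P ≥ k − 1`), uniformly in `q`.
The same proof as RankLevelSetRuleQFiveWhole (paper §13): `(R̂ − Φ)·den = na·S(q,m) + nb` (**`rhat_sixteen_key`**) with the master
sum `S` of RankLevelSetRuleQSumS, the two-sided continued-fraction bounds `C_27 ≤ S ≤ C_29` (`cfTwentySeven_le_sumS`, `sumS_le_cfTwentyNine`),
and the two certificates `na·C_27 + nb ≥ 0`, `na·C_29 + nb ≥ 0` (`sixteen_lower_nonneg`, `sixteen_upper_nonneg`: polynomials with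
non-negative coefficients in `(q−m−15, m)`, certified by Kronecker polynomial identity testing).  No `sorry`; axioms standard.
-/

namespace PercRepro

open Finset

/-- **THE FAMILY `k = 16` ON ITS WHOLE UNTRUNCATED REGIME, FOR EVERY `q`**: `Φ(q+16, q) ≤ R̂(q, 16, m)` for every `m ≤ q − 15`. -/
theorem rhat_sixteen_whole (q m : ℕ) (hm : m + 15 ≤ q) : phiK (q + 16) q ≤ rhat q 16 m := by
  have hkey := rhat_sixteen_key q m hm
  have hden := denSixteen_pos q m
  have hlo := cfTwentySeven_le_sumS q m (by omega)
  have hhi := sumS_le_cfTwentyNine q m (by omega)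
  have hL := sixteen_lower_nonneg q m hm
  have hU := sixteen_upper_nonneg q m hm
  have hmain : 0 ≤ naSixteen q m * sumS q m + nbSixteen q m := by
    rcases le_total 0 (naSixteen q m) with hA | hA
    · calc (0 : ℚ) ≤ naSixteen q m * (cfTwentySevenN q m / cfTwentySevenD q m) + nbSixteen q m := hL
        _ ≤ naSixteen q m * sumS q m + nbSixteen q m := by
          gcongr
    · calc (0 : ℚ) ≤ naSixteen q m * (cfTwentyNineN q m / cfTwentyNineD q m) + nbSixteen q m := hU
        _ ≤ naSixteen q m * sumS q m + nbSixteen q m := by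
          have := mul_le_mul_of_nonpos_left hhi hA
          linarith
  rw [← sub_nonneg]
  rw [← hkey] at hmain
  exact nonneg_of_mul_nonneg_left hmain hden

/-- The matroid form: Rule Q's equal split pays `Φ(q+16,q)` to every member of every cell `(q+16, q)` with `#P ≤ q − 15`
(the whole untruncated regime of the family `k = 16`), for every `q`. -/
theorem ruleQRecv_ge_sixteen_whole (q m : ℕ) (hm : m + 15 ≤ q) : phiK (q + 16) q ≤ rhat q 16 m :=
  rhat_sixteen_whole q m hm

end PercRepro
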